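import Literature.NumberTheory.Automorphic.SchwartzBruhatL2Dense
import Literature.NumberTheory.Automorphic.SmoothRepresentationLocallyConstant
import Mathlib.Analysis.Normed.Operator.Extend
import Mathlib.Topology.UniformSpace.UniformApproximation
import Mathlib.LinearAlgebra.GeneralLinearGroup.Basic
import HarnessLib

/-!
# An `L²`-isometric group action on `𝒮(X)` extends to a UNITARY representation on `L²(X, ν)`

Topic `NumberTheory/Automorphic`; namespace `Literature.NumberTheory.Automorphic` (dot-notation extensions of
`Representation.IsL2Isometric` of `SchwartzBruhatL2Norm.lean`).  KERNEL ONLY: two definitions with bodies (`unitaryOp`,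
`toUnitaryRep`) and proved theorems; no named fact, no record, no `sorry`.

[Weil1964, Chap. I n° 13] realises the operators of the metaplectic group as UNITARY operators of `L²(X)` that preserve the
dense subspace `𝒮(X)` of Schwartz–Bruhat functions; the tree builds them the other way round — as operators of `𝒮(X)`
(`SchrodingerModel`, `LocalUnitarySplittingDatum.localOmega`, …) shown to be `L²`-ISOMETRIC
(`Representation.IsL2Isometric`, `GelbartRogawski1991/LocalSplittingUnitary.lean`).  This file closes the loop: for a GROUP
`G` acting on `𝒮(X)` by `L²(ν)`-isometric operators, with `𝒮(X) → L²(X, ν)` of dense range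
(`SchwartzBruhat.denseRange_toLp`),

* §1 `IsL2Isometric.norm_toLp_apply` (`‖[ρ g Φ]‖_{L²} = ‖[Φ]‖_{L²}`);
* §2 **`IsL2Isometric.unitaryOp h hd g : Lp ℂ 2 ν ≃ₗᵢ[ℂ] Lp ℂ 2 ν`** — the unique extension of `ρ g` to a surjective linear
  isometry (= unitary operator) of `L²(X, ν)` (Mathlib's `LinearEquiv.extendOfIsometry`), `unitaryOp_toLp`
  (`unitaryOp g [Φ] = [ρ g Φ]`), uniqueness among continuous maps (`eq_unitaryOp_of_apply_toLp`);
* §3 **`IsL2Isometric.toUnitaryRep h hd : G →* (Lp ℂ 2 ν ≃ₗᵢ[ℂ] Lp ℂ 2 ν)`** — these extensions form a HOMOMORPHISM (a unitary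
  representation of `G` on the Hilbert space `L²(X, ν)`), `toUnitaryRep_apply_toLp`, `norm_toUnitaryRep_apply`,
  `inner_toUnitaryRep_apply` (unitarity for the inner product);
* §4 STRONG CONTINUITY (`G` a topological group): if the orbit maps `g ↦ [ρ g Φ]` are continuous for `Φ ∈ 𝒮(X)` — in
  particular if `ρ` is SMOOTH (`Representation.IsSmooth`: orbit maps locally constant) — then every orbit map
  `g ↦ toUnitaryRep g f`, `f ∈ L²(X, ν)`, is continuous (`continuous_toUnitaryRep_apply(_of_isSmooth)`: uniform
  approximation, the operators being isometries).

Use (Track 2 of the Hodge/COR-CM cell's [GelbartRogawski1991, Prop. 3.1.1] citation — printed for the unitary `ω_ψ` on the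
Hilbert space of `ρ_ψ`): applied to the tree's local Weil representations `LocalSplittingDatum.localOmega` /
`FinLocalSplittings.omegaLoc` (L²-isometric by `GelbartRogawski1991/LocalSplittingUnitary.lean`) it yields genuine, strongly
continuous, unitary representations of `U(J)(F_v)` on `L²(F_vᴺ)`.  Nothing of [Weil1964] or [GelbartRogawski1991] is asserted.

## References
* [Weil1964] A. Weil, *Sur certains groupes d'opérateurs unitaires*, Acta Math. 111 (1964) 143–211, Chap. I n° 11–13.
* [GelbartRogawski1991] S. Gelbart, J. Rogawski, Invent. Math. 105 (1991), §3.1 p. 454 L21–25 (`ω_ψ : (g, M_g) ↦ M_g` is a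
  unitary representation of `Mp_𝐀(W)`).
-/

set_option autoImplicit false

noncomputable section

open _root_.MeasureTheory Set _root_.Filter
open scoped ENNReal NNReal Topology InnerProductSpace

/-! ## §1 The `L²` norm of the operators of an `L²`-isometric action -/

namespace Literature.NumberTheory.Automorphic

variable {G : Type*} [Group G] {X : Type*} [TopologicalSpace X] [MeasurableSpace X] [OpensMeasurableSpace X]
  {ν : Measure X} [IsFiniteMeasureOnCompacts ν] {ρ : Representation ℂ G (SchwartzBruhat X)}

/-- an `L²(ν)`-isometric operator preserves the `L²` norm of the classes: `‖[ρ g Φ]‖ = ‖[Φ]‖`. [cite: Weil1964, Chap. I n° 13] -/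
theorem _root_.Representation.IsL2Isometric.norm_toLp_apply (h : ρ.IsL2Isometric ν) (g : G) (Φ : SchwartzBruhat X) :
    ‖SchwartzBruhat.toLp ν (ρ g Φ)‖ = ‖SchwartzBruhat.toLp ν Φ‖ :=
  SchwartzBruhat.norm_toLp_eq_of_l2NormSq_eq ν (h g Φ)

/-! ## §2 The unitary extension of one operator -/

/-- **the UNITARY operator of `L²(X, ν)` extending `ρ g`**: the unique surjective linear isometry `U_g` of `Lp ℂ 2 ν` with
`U_g [Φ] = [ρ g Φ]` for all `Φ ∈ 𝒮(X)` — extension by density (`hd`) and completeness of `L²` of the norm-preserving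
(`h`) linear automorphism `ρ g` of `𝒮(X)`. [cite: Weil1964, Chap. I n° 13] -/
def _root_.Representation.IsL2Isometric.unitaryOp (h : ρ.IsL2Isometric ν)
    (hd : DenseRange (SchwartzBruhat.toLp ν : SchwartzBruhat X → Lp ℂ 2 ν)) (g : G) : Lp ℂ 2 ν ≃ₗᵢ[ℂ] Lp ℂ 2 ν :=
  -- `ρ g` as a linear automorphism of `𝒮(X)` (inverse `ρ g⁻¹`): Mathlib's `asGroupHom` + `GeneralLinearGroup.toLinearEquiv`
  (LinearMap.GeneralLinearGroup.toLinearEquiv (ρ.asGroupHom g)).extendOfIsometry (SchwartzBruhat.toLp ν)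
    (SchwartzBruhat.toLp ν) hd hd fun Φ => h.norm_toLp_apply g Φ

variable (h : ρ.IsL2Isometric ν) (hd : DenseRange (SchwartzBruhat.toLp ν : SchwartzBruhat X → Lp ℂ 2 ν))

/-- **`U_g [Φ] = [ρ g Φ]`** on Schwartz–Bruhat classes. [cite: Weil1964, Chap. I n° 13] -/
@[simp] theorem _root_.Representation.IsL2Isometric.unitaryOp_toLp (g : G) (Φ : SchwartzBruhat X) :
    h.unitaryOp hd g (SchwartzBruhat.toLp ν Φ) = SchwartzBruhat.toLp ν (ρ g Φ) :=
  LinearEquiv.extendOfIsometry_eq _ _ _ hd hd _ Φ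

/-- **uniqueness**: a CONTINUOUS self-map of `L²(X, ν)` that agrees with `[Φ] ↦ [ρ g Φ]` on Schwartz–Bruhat classes is `U_g`.
[cite: Weil1964, Chap. I n° 13] -/
theorem _root_.Representation.IsL2Isometric.eq_unitaryOp_of_apply_toLp (g : G) {T : Lp ℂ 2 ν → Lp ℂ 2 ν}
    (hT : Continuous T) (hTρ : ∀ Φ : SchwartzBruhat X, T (SchwartzBruhat.toLp ν Φ) = SchwartzBruhat.toLp ν (ρ g Φ)) :
    T = h.unitaryOp hd g := by
  funext f
  refine hd.induction_on f (isClosed_eq hT (h.unitaryOp hd g).continuous) fun Φ => ?_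
  rw [hTρ, Representation.IsL2Isometric.unitaryOp_toLp]

/-- `U_1 = 1`. [cite: Weil1964, Chap. I n° 13] -/
theorem _root_.Representation.IsL2Isometric.unitaryOp_one : h.unitaryOp hd 1 = 1 := by
  refine LinearIsometryEquiv.ext fun f => ?_
  have := h.eq_unitaryOp_of_apply_toLp hd 1 (T := id) continuous_id fun Φ => by rw [map_one]; rfl
  exact (congrFun this f).symm

/-- **`U_{g g'} = U_g U_{g'}`**. [cite: Weil1964, Chap. I n° 13] -/
theorem _root_.Representation.IsL2Isometric.unitaryOp_mul (g g' : G) :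
    h.unitaryOp hd (g * g') = h.unitaryOp hd g * h.unitaryOp hd g' := by
  refine LinearIsometryEquiv.ext fun f => ?_
  have := h.eq_unitaryOp_of_apply_toLp hd (g * g') (T := fun f => h.unitaryOp hd g (h.unitaryOp hd g' f))
    ((h.unitaryOp hd g).continuous.comp (h.unitaryOp hd g').continuous) fun Φ => by
      simp only [Representation.IsL2Isometric.unitaryOp_toLp, map_mul, Module.End.mul_apply]
  exact (congrFun this f).symm

/-- `U_{g⁻¹} = U_g⁻¹`. [cite: Weil1964, Chap. I n° 13] -/
theorem _root_.Representation.IsL2Isometric.unitaryOp_inv (g : G) : h.unitaryOp hd g⁻¹ = (h.unitaryOp hd g)⁻¹ :=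
  eq_inv_of_mul_eq_one_left (by rw [← Representation.IsL2Isometric.unitaryOp_mul, inv_mul_cancel,
    Representation.IsL2Isometric.unitaryOp_one])

/-! ## §3 The unitary representation on `L²(X, ν)` -/

/-- **the UNITARY REPRESENTATION of `G` on `L²(X, ν)` extending an `L²`-isometric action on `𝒮(X)`**:
`g ↦ U_g`, a homomorphism into the group of surjective linear isometries of the Hilbert space `Lp ℂ 2 ν`.
[cite: Weil1964, Chap. I n° 13] -/
def _root_.Representation.IsL2Isometric.toUnitaryRep : G →* (Lp ℂ 2 ν ≃ₗᵢ[ℂ] Lp ℂ 2 ν) where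
  toFun := h.unitaryOp hd
  map_one' := h.unitaryOp_one hd
  map_mul' := h.unitaryOp_mul hd

/-- unfolding. [cite: Weil1964, Chap. I n° 13] -/
theorem _root_.Representation.IsL2Isometric.toUnitaryRep_apply (g : G) : h.toUnitaryRep hd g = h.unitaryOp hd g := rfl

/-- **`toUnitaryRep g [Φ] = [ρ g Φ]`**: the unitary representation extends the given action. [cite: Weil1964, Chap. I n° 13] -/
@[simp] theorem _root_.Representation.IsL2Isometric.toUnitaryRep_apply_toLp (g : G) (Φ : SchwartzBruhat X) :
    h.toUnitaryRep hd g (SchwartzBruhat.toLp ν Φ) = SchwartzBruhat.toLp ν (ρ g Φ) :=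
  h.unitaryOp_toLp hd g Φ

/-- unitarity, norm form: `‖toUnitaryRep g f‖ = ‖f‖` for every `f ∈ L²(X, ν)`. [cite: Weil1964, Chap. I n° 13] -/
theorem _root_.Representation.IsL2Isometric.norm_toUnitaryRep_apply (g : G) (f : Lp ℂ 2 ν) :
    ‖h.toUnitaryRep hd g f‖ = ‖f‖ :=
  (h.unitaryOp hd g).norm_map f

/-- unitarity, inner-product form: `⟪toUnitaryRep g f, toUnitaryRep g f'⟫ = ⟪f, f'⟫`. [cite: Weil1964, Chap. I n° 13] -/
theorem _root_.Representation.IsL2Isometric.inner_toUnitaryRep_apply (g : G) (f f' : Lp ℂ 2 ν) :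
    ⟪h.toUnitaryRep hd g f, h.toUnitaryRep hd g f'⟫_ℂ = ⟪f, f'⟫_ℂ :=
  (h.unitaryOp hd g).inner_map_map f f'

/-- surjectivity of each `toUnitaryRep g` (unitary, not merely isometric). [cite: Weil1964, Chap. I n° 13] -/
theorem _root_.Representation.IsL2Isometric.surjective_toUnitaryRep (g : G) : Function.Surjective (h.toUnitaryRep hd g) :=
  (h.unitaryOp hd g).surjective

/-- **uniqueness of the unitary representation**: any family of continuous self-maps `T g` of `L²(X, ν)` extending the action
on Schwartz–Bruhat classes coincides with `toUnitaryRep`. [cite: Weil1964, Chap. I n° 13] -/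
theorem _root_.Representation.IsL2Isometric.eq_toUnitaryRep_of_apply_toLp {T : G → Lp ℂ 2 ν → Lp ℂ 2 ν}
    (hT : ∀ g, Continuous (T g)) (hTρ : ∀ (g : G) (Φ : SchwartzBruhat X), T g (SchwartzBruhat.toLp ν Φ) = SchwartzBruhat.toLp ν (ρ g Φ))
    (g : G) : T g = h.toUnitaryRep hd g :=
  h.eq_unitaryOp_of_apply_toLp hd g (hT g) (hTρ g)

/-! ## §4 Strong continuity -/

section Continuity

variable [TopologicalSpace G]

/-- **strong continuity from the dense subspace**: if every orbit map `g ↦ [ρ g Φ]` (`Φ ∈ 𝒮(X)`) is continuous, then so is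
every orbit map `g ↦ toUnitaryRep g f`, `f ∈ L²(X, ν)` — `g ↦ U_g f` is a UNIFORM limit of the continuous maps
`g ↦ U_g [Φ]` since the `U_g` are isometries (`‖U_g f − U_g [Φ]‖ = ‖f − [Φ]‖`). [cite: Weil1964, Chap. I n° 13] -/
theorem _root_.Representation.IsL2Isometric.continuous_toUnitaryRep_apply
    (hc : ∀ Φ : SchwartzBruhat X, Continuous fun g : G => SchwartzBruhat.toLp ν (ρ g Φ)) (f : Lp ℂ 2 ν) :
    Continuous fun g : G => h.toUnitaryRep hd g f := by
  refine continuous_of_uniform_approx_of_continuous fun u hu => ?_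
  obtain ⟨ε, hε, hεu⟩ := Metric.mem_uniformity_dist.1 hu
  obtain ⟨Φ, hΦ⟩ := Metric.denseRange_iff.1 hd f ε hε
  refine ⟨fun g : G => h.toUnitaryRep hd g (SchwartzBruhat.toLp ν Φ), ?_, fun g => hεu ?_⟩
  · simp only [Representation.IsL2Isometric.toUnitaryRep_apply_toLp]
    exact hc Φ
  · rw [dist_eq_norm, ← map_sub, Representation.IsL2Isometric.norm_toUnitaryRep_apply, ← dist_eq_norm]
    exact hΦ

/-- **a SMOOTH `L²`-isometric action extends to a STRONGLY CONTINUOUS unitary representation**: for `ρ` smooth (every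
Schwartz–Bruhat vector has open stabiliser, `Representation.IsSmooth`) the orbit maps `g ↦ [ρ g Φ]` are locally constant,
hence continuous, and §4's first lemma applies. [cite: Weil1964, Chap. I n° 13] -/
theorem _root_.Representation.IsL2Isometric.continuous_toUnitaryRep_apply_of_isSmooth [SeparatelyContinuousMul G]
    (hs : ρ.IsSmooth) (f : Lp ℂ 2 ν) : Continuous fun g : G => h.toUnitaryRep hd g f :=
  h.continuous_toUnitaryRep_apply hd
    (fun Φ => ((hs.isLocallyConstant_apply ρ Φ).comp (SchwartzBruhat.toLp ν)).continuous) f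

end Continuity

section Dense

variable [BorelSpace X] [LocallyCompactSpace X] [T2Space X] [TotallyDisconnectedSpace X] [ν.OuterRegular]
  [ν.InnerRegularCompactLTTop]

/-- the density hypothesis DISCHARGED in the totally disconnected locally compact setting (`SchwartzBruhat.denseRange_toLp`):
**every `L²(ν)`-isometric action of a group on `𝒮(X)` IS (the restriction of) a unitary representation on `L²(X, ν)`** —
`X` locally compact Hausdorff totally disconnected, `ν` outer regular and inner regular on finite-measure sets (e.g. a Haar
measure on `F_vᴺ`). [cite: Weil1964, Chap. I n° 13] -/
theorem _root_.Representation.IsL2Isometric.exists_unitaryRep (h : ρ.IsL2Isometric ν) :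
    ∃ U : G →* (Lp ℂ 2 ν ≃ₗᵢ[ℂ] Lp ℂ 2 ν),
      ∀ (g : G) (Φ : SchwartzBruhat X), U g (SchwartzBruhat.toLp ν Φ) = SchwartzBruhat.toLp ν (ρ g Φ) :=
  ⟨h.toUnitaryRep (SchwartzBruhat.denseRange_toLp ν), fun g Φ => h.toUnitaryRep_apply_toLp _ g Φ⟩

end Dense

end Literature.NumberTheory.Automorphic

end
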